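import Summits.Parity.GeneralizedHardyLittlewood.Theorems.PrimeLevelFamEdgeMomentsBeyondDiagonalDiagDecorMonomial
import HarnessLib

/-!
# Route `PrimeLevelFamEdge`, crux K_A `MomentsBeyondDiagonal` (stmt-Parity-20007), line «petersson_layers» v4, stub `stub_diag`:
# **the bilinear harmonic assembly and the product-monomial master step with TWO-SCALE errors
# `|𝒮_i(n) − E_n R_i(u_n)/log^{s_i}M| ≤ C_i·D(n)·((1+κ(n))/log^{s_i+1}M + 1/((1+log(M/n))²·log^{s_i}M))`**

Census R3(ii), ANALYTIC HALF. The UNDECORATED profile coordinate of `…DiagProfileCoord` (`t = τ`, main term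
`E_n P″(u_n)/log²M`, p814057) carries the two-scale error `C·D(n)(1/((1+log(M/n))²log²M) + 1/log³M)` of the order-2
engine, which is not `O(D(n)/log³M)` uniformly in `n` but is summable against `1/n` by the dyadic lemma
(`KernelFormXSqSums.sum_divWeight_sq_dyadic_le`). The order-`(1,1)` weight contains the mixed monomials
`τ(k₁)·τ_{1,1}(k₂)`, `τ(k₁)·τ_{1,0}(k₂)·(…)`, so the master step of `…DiagDecorMonomial` is re-run with the two-scale
hypothesis (which also contains the one-scale decorated format of `…DiagDecorProfileCoord`):

* `abs_bilinearHarmonic_two_scale_sub_le` — **`|Σ_{n≤M} φ(n)W(n)² S₁S₂ − (π²/6)²(∫₀¹R₁R₂)·log M/log^{s₁+s₂}M| ≤ C/log^{s₁+s₂}M`**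
  under the two-scale hypotheses (per-`n` error `≤ X·D(n)²((1+κ(n))/log M + (1+log(M/n))⁻²)/(n·log^{s₁+s₂}M)`, summed by
  `Σ D²(1+κ)/n ≪ log M` and the dyadic lemma);
* `abs_selbergMonomial_two_scale_sub_le` — **the product-monomial master step under the two-scale hypotheses**
  (`…DiagDecorMonomial.selbergInner_eq_W_sq_mul` + `…DiagDecorCollapse.selbergCollapse_zero` + the above).

With `…DiagProfileCoord.abs_profileCoord_sub_derivative2_le` (`t = τ ↦ (R,s) = (P″,2)`) and `…DiagDecorProfileCoord`
(`τ_{1,1} ↦ (P,0)`, `τ_{1,0} ↦ (−P′,1)`, `τ_{2,0} ↦ (0,0)`) every `log g`-free product monomial of the orders `(1,1)`, `(2,0)`,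
`(0,2)` without extra `log k` powers is now ONE application. Def-free; theorems only. Helper `--supports stmt-Parity-20007`;
closes nothing; K_A, K_B and the Parity summit are NOT proved; nothing about Landau–Siegel zeros.

## References
* E. Kowalski, P. Michel, J. VanderKam, J. reine angew. Math. 526 (2000), (23)–(28) pp. 13–15 and Prop. 5.1 p. 18.
  [cite: KowalskiMichelVanderKam2000, Prop. 5.1 — derivation (bilinear n-sums, two-scale errors)]
-/

noncomputable section

open scoped Real ArithmeticFunction.Moebius
open Finset ArithmeticFunction Polynomial MeasureTheory intervalIntegral

namespace Summit.Parity.GeneralizedHardyLittlewood.Theorems.MomentsBeyondDiagonal.DiagKernel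

open Literature.NumberTheory.LFunctions Literature.NumberTheory.LFunctions.KMV2000
open MollifierMainTerm (W)
open SelbergCoord (kappa)
open Literature.NumberTheory.Sieve (one_le_log_of_three_le)
open Summit.Parity.GeneralizedHardyLittlewood.Theorems.BeyondDiagonalBeatsQuarter.KernelFormXSq
  (mainConst divWeight divWeight_nonneg mainConst_nonneg mainConst_le_divWeight
    totient_mul_W_sq_mul_mainConst totient_mul_W_sq_le sum_divWeight_sq_div_le sum_divWeight_sq_dyadic_le
    sum_kappa_divWeight_sq_div_le)

set_option maxHeartbeats 400000 in
/-- **The bilinear harmonic assembly, two-scale errors.** Let `R₁, R₂` be real polynomials, `s₁, s₂ : ℕ`, and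
`S₁ S₂ : ℝ → ℕ → ℝ` with, for `M ≥ 3`, `1 ≤ n ≤ M`,
`|S_i M n − E_n R_i(log(M/n)/log M)/log^{s_i}M| ≤ C_i·D(n)·((1+κ(n))/log^{s_i+1}M + 1/((1+log(M/n))²log^{s_i}M))`. Then there
is `C` with `|Σ_{n≤M} φ(n)W(n)²·S₁ M n·S₂ M n − (π²/6)²(∫₀¹R₁R₂)·log M/log^{s₁+s₂}M| ≤ C/log^{s₁+s₂}M` for all `M ≥ 3`.
[cite: KowalskiMichelVanderKam2000, Prop. 5.1 — derivation (bilinear n-sums of the diagonal main term)] -/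
theorem abs_bilinearHarmonic_two_scale_sub_le (R₁ R₂ : ℝ[X]) (s₁ s₂ : ℕ) (S₁ S₂ : ℝ → ℕ → ℝ) {C₁ C₂ : ℝ}
    (hC₁ : 0 ≤ C₁) (hC₂ : 0 ≤ C₂)
    (h₁ : ∀ M : ℝ, 3 ≤ M → ∀ n : ℕ, n ≠ 0 → (n : ℝ) ≤ M →
      |S₁ M n - mainConst n * R₁.eval (Real.log (M / n) / Real.log M) / Real.log M ^ s₁| ≤
        C₁ * divWeight n * ((1 + kappa n) / Real.log M ^ (s₁ + 1) +
          1 / ((1 + Real.log (M / n)) ^ 2 * Real.log M ^ s₁)))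
    (h₂ : ∀ M : ℝ, 3 ≤ M → ∀ n : ℕ, n ≠ 0 → (n : ℝ) ≤ M →
      |S₂ M n - mainConst n * R₂.eval (Real.log (M / n) / Real.log M) / Real.log M ^ s₂| ≤
        C₂ * divWeight n * ((1 + kappa n) / Real.log M ^ (s₂ + 1) +
          1 / ((1 + Real.log (M / n)) ^ 2 * Real.log M ^ s₂))) :
    ∃ C : ℝ, 0 < C ∧ ∀ M : ℝ, 3 ≤ M →
      |∑ n ∈ Icc 1 ⌊M⌋₊, (Nat.totient n : ℝ) * W n ^ 2 * (S₁ M n * S₂ M n) -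
          (π ^ 2 / 6) ^ 2 * (∫ u in (0 : ℝ)..1, (R₁ * R₂).eval u) * Real.log M / Real.log M ^ (s₁ + s₂)| ≤
        C / Real.log M ^ (s₁ + s₂) := by
  have abs_eval_le : ∀ (R : ℝ[X]) {u : ℝ}, 0 ≤ u → u ≤ 1 →
      |R.eval u| ≤ ∑ i ∈ Finset.range (R.natDegree + 1), |R.coeff i| := by
    intro R u hu0 hu1
    rw [Polynomial.eval_eq_sum_range]
    refine (Finset.abs_sum_le_sum_abs _ _).trans (Finset.sum_le_sum fun i _ ↦ ?_)
    rw [abs_mul, abs_pow, abs_of_nonneg hu0]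
    exact mul_le_of_le_one_right (abs_nonneg _) (pow_le_one₀ hu0 hu1)
  obtain ⟨C_R, hC_R, hR⟩ := abs_sum_absW_mainConst_mul_eval_sub_integral_le (R₁ * R₂)
  obtain ⟨C_E, hC_E, hE⟩ := mainConst_le_divWeight
  set B₁ : ℝ := ∑ i ∈ Finset.range (R₁.natDegree + 1), |R₁.coeff i| with hB₁
  set B₂ : ℝ := ∑ i ∈ Finset.range (R₂.natDegree + 1), |R₂.coeff i| with hB₂
  have hB₁0 : 0 ≤ B₁ := Finset.sum_nonneg fun i _ ↦ abs_nonneg _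
  have hB₂0 : 0 ≤ B₂ := Finset.sum_nonneg fun i _ ↦ abs_nonneg _
  set A : ℝ := (∑' d : ℕ, (d : ℝ) ^ (-(5 / 4 : ℝ))) ^ 2 with hA
  have hA0 : 0 ≤ A := by positivity
  set X : ℝ := C_E * B₁ * C₂ + C₁ * C_E * B₂ + 3 * C₁ * C₂ with hX
  have hX0 : 0 ≤ X := by positivity
  set K : ℝ := X * (155 * A) with hK
  have hK0 : 0 ≤ K := by positivity
  refine ⟨π ^ 2 / 6 * C_R + K + 1, by positivity, fun M hM ↦ ?_⟩
  set ℓ := Real.log M with hℓ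
  have hℓ1 : 1 ≤ ℓ := one_le_log_of_three_le hM
  have hℓ0 : 0 < ℓ := by linarith
  have hM0 : 0 < M := by linarith
  have hM1 : 1 ≤ M := by linarith
  set N := ⌊M⌋₊ with hN
  have hN1 : 1 ≤ N := Nat.le_floor (by norm_num; linarith)
  have hlogN : Real.log N ≤ ℓ := Real.log_le_log (by exact_mod_cast hN1) (Nat.floor_le hM0.le)
  set m₁ : ℕ → ℝ := fun n ↦ mainConst n * R₁.eval (Real.log (M / n) / ℓ) / ℓ ^ s₁ with hm₁
  set m₂ : ℕ → ℝ := fun n ↦ mainConst n * R₂.eval (Real.log (M / n) / ℓ) / ℓ ^ s₂ with hm₂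
  have hrange : ∀ n ∈ Icc 1 N, n ≠ 0 ∧ (n : ℝ) ≤ M ∧ 0 ≤ Real.log (M / n) / ℓ ∧ Real.log (M / n) / ℓ ≤ 1 ∧
      0 ≤ Real.log (M / n) := by
    intro n hn
    have hn' := Finset.mem_Icc.1 hn
    have hn0 : n ≠ 0 := by omega
    have hnM : (n : ℝ) ≤ M := le_trans (by exact_mod_cast hn'.2) (Nat.floor_le hM0.le)
    obtain ⟨hy0, hyℓ⟩ := log_div_nonneg_and_le hM hn0 hnM
    exact ⟨hn0, hnM, div_nonneg hy0 hℓ0.le, (div_le_one hℓ0).2 hyℓ, hy0⟩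
  -- Step 1: the main part
  have hmain_eq : ∑ n ∈ Icc 1 N, (Nat.totient n : ℝ) * W n ^ 2 * (m₁ n * m₂ n) =
      π ^ 2 / 6 / ℓ ^ (s₁ + s₂) * ∑ n ∈ Icc 1 N, |W n| * mainConst n * (R₁ * R₂).eval (Real.log (M / n) / ℓ) := by
    rw [Finset.mul_sum]
    refine Finset.sum_congr rfl fun n hn ↦ ?_
    obtain ⟨hn0, -⟩ := hrange n hn
    have hid := totient_mul_W_sq_mul_mainConst hn0
    simp only [hm₁, hm₂, Polynomial.eval_mul]
    rw [pow_add]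
    have : (Nat.totient n : ℝ) * W n ^ 2 * (mainConst n * R₁.eval (Real.log (M / n) / ℓ) / ℓ ^ s₁ *
        (mainConst n * R₂.eval (Real.log (M / n) / ℓ) / ℓ ^ s₂)) =
        ((Nat.totient n : ℝ) * W n ^ 2 * mainConst n) * mainConst n *
          (R₁.eval (Real.log (M / n) / ℓ) * R₂.eval (Real.log (M / n) / ℓ)) / (ℓ ^ s₁ * ℓ ^ s₂) := by
      field_simp
    rw [this, hid]
    field_simp
  have hmain : |∑ n ∈ Icc 1 N, (Nat.totient n : ℝ) * W n ^ 2 * (m₁ n * m₂ n) -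
      (π ^ 2 / 6) ^ 2 * (∫ u in (0 : ℝ)..1, (R₁ * R₂).eval u) * ℓ / ℓ ^ (s₁ + s₂)| ≤
      π ^ 2 / 6 * C_R / ℓ ^ (s₁ + s₂) := by
    rw [hmain_eq]
    have e : (π ^ 2 / 6) ^ 2 * (∫ u in (0 : ℝ)..1, (R₁ * R₂).eval u) * ℓ / ℓ ^ (s₁ + s₂) =
        π ^ 2 / 6 / ℓ ^ (s₁ + s₂) * (π ^ 2 / 6 * ℓ * ∫ u in (0 : ℝ)..1, (R₁ * R₂).eval u) := by
      field_simp
    rw [e, ← mul_sub, abs_mul, abs_of_pos (by positivity : (0 : ℝ) < π ^ 2 / 6 / ℓ ^ (s₁ + s₂))]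
    calc π ^ 2 / 6 / ℓ ^ (s₁ + s₂) * |∑ n ∈ Icc 1 N, |W n| * mainConst n * (R₁ * R₂).eval (Real.log (M / n) / ℓ) -
          π ^ 2 / 6 * ℓ * ∫ u in (0 : ℝ)..1, (R₁ * R₂).eval u|
        ≤ π ^ 2 / 6 / ℓ ^ (s₁ + s₂) * C_R := mul_le_mul_of_nonneg_left (hR M hM) (by positivity)
      _ = π ^ 2 / 6 * C_R / ℓ ^ (s₁ + s₂) := by ring
  -- Step 2: termwise error bound with the two scales `a = (1+κ)/ℓ`, `b = (1+log(M/n))⁻²`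
  have herr : ∀ n ∈ Icc 1 N, |(Nat.totient n : ℝ) * W n ^ 2 * (S₁ M n * S₂ M n) -
      (Nat.totient n : ℝ) * W n ^ 2 * (m₁ n * m₂ n)| ≤
      (n : ℝ)⁻¹ * (X * (divWeight n ^ 2 * ((1 + kappa n) / ℓ + 1 / (1 + Real.log (M / n)) ^ 2)) /
        ℓ ^ (s₁ + s₂)) := by
    intro n hn
    obtain ⟨hn0, hnM, hu0, hu1, hY0⟩ := hrange n hn
    have hD := divWeight_nonneg n
    have hE0 := mainConst_nonneg n
    have hEn := hE n hn0
    have hκ : 0 ≤ kappa n := by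
      unfold kappa
      exact Finset.sum_nonneg fun p hp ↦ by
        have hp2 : (2 : ℝ) ≤ p := by exact_mod_cast (Nat.prime_of_mem_primeFactors hp).two_le
        exact div_nonneg (Real.log_nonneg (by linarith)) (by linarith)
    have hκℓ : kappa n ≤ ℓ := by
      refine (kappa_le_log hn0).trans ?_
      exact Real.log_le_log (by exact_mod_cast Nat.pos_of_ne_zero hn0) hnM
    have hφW := totient_mul_W_sq_le n
    have hφW0 : 0 ≤ (Nat.totient n : ℝ) * W n ^ 2 := by positivity
    have hn0' : (0 : ℝ) < n := by exact_mod_cast Nat.pos_of_ne_zero hn0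
    set Y := Real.log (M / n) with hY
    set a : ℝ := (1 + kappa n) / ℓ with ha
    set b : ℝ := 1 / (1 + Y) ^ 2 with hb
    have ha0 : 0 ≤ a := by positivity
    have hb0 : 0 ≤ b := by positivity
    have ha2 : a ≤ 2 := by rw [ha, div_le_iff₀ hℓ0]; linarith
    have hb1 : b ≤ 1 := by
      rw [hb, div_le_one (by positivity)]; nlinarith
    set e₁ := S₁ M n - m₁ n with he₁
    set e₂ := S₂ M n - m₂ n with he₂
    -- the hypotheses in the `(a + b)/ℓ^s` form
    have hfmt : ∀ (s : ℕ) (Cc : ℝ), Cc * divWeight n * ((1 + kappa n) / ℓ ^ (s + 1) + 1 / ((1 + Y) ^ 2 * ℓ ^ s)) =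
        Cc * divWeight n * (a + b) / ℓ ^ s := by
      intro s Cc
      rw [ha, hb, pow_succ]
      field_simp
    have he₁b : |e₁| ≤ C₁ * divWeight n * (a + b) / ℓ ^ s₁ := by
      have := h₁ M hM n hn0 hnM; rwa [hfmt] at this
    have he₂b : |e₂| ≤ C₂ * divWeight n * (a + b) / ℓ ^ s₂ := by
      have := h₂ M hM n hn0 hnM; rwa [hfmt] at this
    have hm₁b : |m₁ n| ≤ C_E * divWeight n * B₁ / ℓ ^ s₁ := by
      simp only [hm₁]
      rw [abs_div, abs_mul, abs_of_nonneg hE0, abs_of_pos (pow_pos hℓ0 _)]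
      gcongr
      exact abs_eval_le R₁ hu0 hu1
    have hm₂b : |m₂ n| ≤ C_E * divWeight n * B₂ / ℓ ^ s₂ := by
      simp only [hm₂]
      rw [abs_div, abs_mul, abs_of_nonneg hE0, abs_of_pos (pow_pos hℓ0 _)]
      gcongr
      exact abs_eval_le R₂ hu0 hu1
    have hdec : (Nat.totient n : ℝ) * W n ^ 2 * (S₁ M n * S₂ M n) - (Nat.totient n : ℝ) * W n ^ 2 * (m₁ n * m₂ n) =
        (Nat.totient n : ℝ) * W n ^ 2 * (m₁ n * e₂ + e₁ * m₂ n + e₁ * e₂) := by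
      simp only [he₁, he₂]; ring
    rw [hdec, abs_mul, abs_of_nonneg hφW0]
    have hp1 : |m₁ n * e₂| ≤ (C_E * divWeight n * B₁ / ℓ ^ s₁) * (C₂ * divWeight n * (a + b) / ℓ ^ s₂) := by
      rw [abs_mul]; exact mul_le_mul hm₁b he₂b (abs_nonneg _) (by positivity)
    have hp2 : |e₁ * m₂ n| ≤ (C₁ * divWeight n * (a + b) / ℓ ^ s₁) * (C_E * divWeight n * B₂ / ℓ ^ s₂) := by
      rw [abs_mul]; exact mul_le_mul he₁b hm₂b (abs_nonneg _) (by positivity)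
    have hp3 : |e₁ * e₂| ≤ (C₁ * divWeight n * (a + b) / ℓ ^ s₁) * (C₂ * divWeight n * (a + b) / ℓ ^ s₂) := by
      rw [abs_mul]; exact mul_le_mul he₁b he₂b (abs_nonneg _) (by positivity)
    have hab3 : (a + b) * (a + b) ≤ (a + b) * 3 := mul_le_mul_of_nonneg_left (by linarith) (by positivity)
    have hsum3 : |m₁ n * e₂ + e₁ * m₂ n + e₁ * e₂| ≤ X * (divWeight n ^ 2 * (a + b)) / ℓ ^ (s₁ + s₂) := by
      have hℓpow : ℓ ^ s₁ * ℓ ^ s₂ = ℓ ^ (s₁ + s₂) := by ring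
      calc |m₁ n * e₂ + e₁ * m₂ n + e₁ * e₂| ≤ |m₁ n * e₂| + |e₁ * m₂ n| + |e₁ * e₂| := abs_add_three _ _ _
        _ ≤ (C_E * divWeight n * B₁ / ℓ ^ s₁) * (C₂ * divWeight n * (a + b) / ℓ ^ s₂) +
            (C₁ * divWeight n * (a + b) / ℓ ^ s₁) * (C_E * divWeight n * B₂ / ℓ ^ s₂) +
            (C₁ * divWeight n * (a + b) / ℓ ^ s₁) * (C₂ * divWeight n * (a + b) / ℓ ^ s₂) :=
            add_le_add (add_le_add hp1 hp2) hp3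
        _ = ((C_E * B₁ * C₂ + C₁ * C_E * B₂) * (divWeight n ^ 2 * (a + b)) +
            C₁ * C₂ * divWeight n ^ 2 * ((a + b) * (a + b))) / ℓ ^ (s₁ + s₂) := by
            rw [div_mul_div_comm, div_mul_div_comm, div_mul_div_comm, hℓpow]
            field_simp
        _ ≤ ((C_E * B₁ * C₂ + C₁ * C_E * B₂) * (divWeight n ^ 2 * (a + b)) +
            C₁ * C₂ * divWeight n ^ 2 * ((a + b) * 3)) / ℓ ^ (s₁ + s₂) := by
            gcongr
        _ = X * (divWeight n ^ 2 * (a + b)) / ℓ ^ (s₁ + s₂) := by rw [hX]; ring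
    exact mul_le_mul hφW hsum3 (abs_nonneg _) (inv_nonneg.2 hn0'.le)
  -- Step 3: sum the errors (`Σ D²(1+κ)/n ≪ log`, dyadic lemma for `Σ D²/(n(1+Y)²)`)
  have hsumD : ∑ n ∈ Icc 1 N, divWeight n ^ 2 * ((1 + kappa n) / ℓ + 1 / (1 + Real.log (M / n)) ^ 2) / n ≤
      155 * A := by
    have h1 := sum_divWeight_sq_div_le hN1
    have h2 := sum_kappa_divWeight_sq_div_le hN1
    have h3 := sum_divWeight_sq_dyadic_le hM1
    rw [← hA] at h1 h2 h3
    rw [← hN] at h3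
    have hsplit : ∑ n ∈ Icc 1 N, divWeight n ^ 2 * ((1 + kappa n) / ℓ + 1 / (1 + Real.log (M / n)) ^ 2) / n =
        (1 / ℓ) * (∑ n ∈ Icc 1 N, divWeight n ^ 2 / n + ∑ n ∈ Icc 1 N, kappa n * divWeight n ^ 2 / n) +
          ∑ n ∈ Icc 1 N, divWeight n ^ 2 / (n * (1 + Real.log (M / n)) ^ 2) := by
      rw [← Finset.sum_add_distrib, Finset.mul_sum, ← Finset.sum_add_distrib]
      refine Finset.sum_congr rfl fun n hn ↦ ?_
      have hn0 : (n : ℝ) ≠ 0 := by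
        have := (Finset.mem_Icc.1 hn).1
        exact_mod_cast (show n ≠ 0 by omega)
      have hY1 : (1 + Real.log (M / n)) ^ 2 ≠ 0 := by
        obtain ⟨-, -, -, -, hY0⟩ := hrange n hn
        positivity
      field_simp
    rw [hsplit]
    have h4 : 2 + Real.log N ≤ 3 * ℓ := by linarith
    have h12 : ∑ n ∈ Icc 1 N, divWeight n ^ 2 / n + ∑ n ∈ Icc 1 N, kappa n * divWeight n ^ 2 / n ≤ 49 * A * (3 * ℓ) := by
      calc _ ≤ A * (2 + Real.log N) + 48 * A * (2 + Real.log N) := add_le_add h1 h2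
        _ = 49 * A * (2 + Real.log N) := by ring
        _ ≤ 49 * A * (3 * ℓ) := mul_le_mul_of_nonneg_left h4 (by positivity)
    calc (1 / ℓ) * (∑ n ∈ Icc 1 N, divWeight n ^ 2 / n + ∑ n ∈ Icc 1 N, kappa n * divWeight n ^ 2 / n) +
          ∑ n ∈ Icc 1 N, divWeight n ^ 2 / (n * (1 + Real.log (M / n)) ^ 2)
        ≤ (1 / ℓ) * (49 * A * (3 * ℓ)) + 8 * A := add_le_add (mul_le_mul_of_nonneg_left h12 (by positivity)) h3
      _ = 155 * A := by field_simp; ring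
  have herrsum : |∑ n ∈ Icc 1 N, (Nat.totient n : ℝ) * W n ^ 2 * (S₁ M n * S₂ M n) -
      ∑ n ∈ Icc 1 N, (Nat.totient n : ℝ) * W n ^ 2 * (m₁ n * m₂ n)| ≤ K / ℓ ^ (s₁ + s₂) := by
    rw [← Finset.sum_sub_distrib]
    calc _ ≤ ∑ n ∈ Icc 1 N, |(Nat.totient n : ℝ) * W n ^ 2 * (S₁ M n * S₂ M n) -
            (Nat.totient n : ℝ) * W n ^ 2 * (m₁ n * m₂ n)| := Finset.abs_sum_le_sum_abs _ _
      _ ≤ ∑ n ∈ Icc 1 N, (n : ℝ)⁻¹ * (X * (divWeight n ^ 2 *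
            ((1 + kappa n) / ℓ + 1 / (1 + Real.log (M / n)) ^ 2)) / ℓ ^ (s₁ + s₂)) := Finset.sum_le_sum herr
      _ = X / ℓ ^ (s₁ + s₂) *
            ∑ n ∈ Icc 1 N, divWeight n ^ 2 * ((1 + kappa n) / ℓ + 1 / (1 + Real.log (M / n)) ^ 2) / n := by
            have hpt : ∀ n : ℕ, (n : ℝ)⁻¹ * (X * (divWeight n ^ 2 *
                ((1 + kappa n) / ℓ + 1 / (1 + Real.log (M / n)) ^ 2)) / ℓ ^ (s₁ + s₂)) =
                X / ℓ ^ (s₁ + s₂) *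
                  (divWeight n ^ 2 * ((1 + kappa n) / ℓ + 1 / (1 + Real.log (M / n)) ^ 2) / n) := fun n ↦ by ring
            rw [Finset.sum_congr rfl fun n _ ↦ hpt n, ← Finset.mul_sum]
      _ ≤ X / ℓ ^ (s₁ + s₂) * (155 * A) := mul_le_mul_of_nonneg_left hsumD (by positivity)
      _ = K / ℓ ^ (s₁ + s₂) := by rw [hK]; ring
  -- Step 4: assembly
  have hfinal : |∑ n ∈ Icc 1 N, (Nat.totient n : ℝ) * W n ^ 2 * (S₁ M n * S₂ M n) -
      (π ^ 2 / 6) ^ 2 * (∫ u in (0 : ℝ)..1, (R₁ * R₂).eval u) * ℓ / ℓ ^ (s₁ + s₂)| ≤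
      (π ^ 2 / 6 * C_R + K) / ℓ ^ (s₁ + s₂) := by
    have e : ∑ n ∈ Icc 1 N, (Nat.totient n : ℝ) * W n ^ 2 * (S₁ M n * S₂ M n) -
        (π ^ 2 / 6) ^ 2 * (∫ u in (0 : ℝ)..1, (R₁ * R₂).eval u) * ℓ / ℓ ^ (s₁ + s₂) =
        (∑ n ∈ Icc 1 N, (Nat.totient n : ℝ) * W n ^ 2 * (S₁ M n * S₂ M n) -
          ∑ n ∈ Icc 1 N, (Nat.totient n : ℝ) * W n ^ 2 * (m₁ n * m₂ n)) +
        (∑ n ∈ Icc 1 N, (Nat.totient n : ℝ) * W n ^ 2 * (m₁ n * m₂ n) -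
          (π ^ 2 / 6) ^ 2 * (∫ u in (0 : ℝ)..1, (R₁ * R₂).eval u) * ℓ / ℓ ^ (s₁ + s₂)) := by ring
    rw [e]
    calc _ ≤ |∑ n ∈ Icc 1 N, (Nat.totient n : ℝ) * W n ^ 2 * (S₁ M n * S₂ M n) -
            ∑ n ∈ Icc 1 N, (Nat.totient n : ℝ) * W n ^ 2 * (m₁ n * m₂ n)| +
          |∑ n ∈ Icc 1 N, (Nat.totient n : ℝ) * W n ^ 2 * (m₁ n * m₂ n) -
            (π ^ 2 / 6) ^ 2 * (∫ u in (0 : ℝ)..1, (R₁ * R₂).eval u) * ℓ / ℓ ^ (s₁ + s₂)| := abs_add_le _ _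
      _ ≤ K / ℓ ^ (s₁ + s₂) + π ^ 2 / 6 * C_R / ℓ ^ (s₁ + s₂) := add_le_add herrsum hmain
      _ = (π ^ 2 / 6 * C_R + K) / ℓ ^ (s₁ + s₂) := by ring
  calc _ ≤ (π ^ 2 / 6 * C_R + K) / ℓ ^ (s₁ + s₂) := hfinal
    _ ≤ (π ^ 2 / 6 * C_R + K + 1) / ℓ ^ (s₁ + s₂) :=
        div_le_div_of_nonneg_right (by linarith) (by positivity)

/-- **The product-monomial master step, two-scale errors.** As `…DiagDecorMonomial.abs_selbergMonomial_sub_le`, with the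
decorated profile coordinates allowed the two-scale error `C_i·D(n)·((1+κ(n))/log^{s_i+1}M + 1/((1+log(M/n))²log^{s_i}M))`
(so `t = τ` with `(R,s) = (P″,2)` from `…DiagProfileCoord` is admissible).
[cite: KowalskiMichelVanderKam2000, (23)–(28) and Prop. 5.1 — derivation (a monomial of the diagonal main term)] -/
theorem abs_selbergMonomial_two_scale_sub_le (P : ℝ[X]) (t₁ t₂ : ℕ → ℝ) (R₁ R₂ : ℝ[X]) (s₁ s₂ : ℕ) {C₁ C₂ : ℝ}
    (hC₁ : 0 ≤ C₁) (hC₂ : 0 ≤ C₂)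
    (h₁ : ∀ M : ℝ, 3 ≤ M → ∀ n : ℕ, n ≠ 0 → (n : ℝ) ≤ M →
      |∑ c ∈ Finset.range (P.natDegree + 1), P.coeff c *
          ((∑ k ∈ Icc 1 ⌊M / n⌋₊, (if k.Coprime n then W k else 0) * t₁ k * Real.log (M / n / k) ^ c) /
            Real.log M ^ c) -
        mainConst n * R₁.eval (Real.log (M / n) / Real.log M) / Real.log M ^ s₁| ≤
        C₁ * divWeight n * ((1 + kappa n) / Real.log M ^ (s₁ + 1) +
          1 / ((1 + Real.log (M / n)) ^ 2 * Real.log M ^ s₁)))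
    (h₂ : ∀ M : ℝ, 3 ≤ M → ∀ n : ℕ, n ≠ 0 → (n : ℝ) ≤ M →
      |∑ c ∈ Finset.range (P.natDegree + 1), P.coeff c *
          ((∑ k ∈ Icc 1 ⌊M / n⌋₊, (if k.Coprime n then W k else 0) * t₂ k * Real.log (M / n / k) ^ c) /
            Real.log M ^ c) -
        mainConst n * R₂.eval (Real.log (M / n) / Real.log M) / Real.log M ^ s₂| ≤
        C₂ * divWeight n * ((1 + kappa n) / Real.log M ^ (s₂ + 1) +
          1 / ((1 + Real.log (M / n)) ^ 2 * Real.log M ^ s₂))) :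
    ∃ C : ℝ, 0 < C ∧ ∀ M : ℝ, 3 ≤ M →
      |∑ c ∈ Icc 1 ⌊M⌋₊, ∑ g ∈ Icc 1 (⌊M⌋₊ / c), (μ g : ℝ) * c *
          ∑ k₁ ∈ Icc 1 (⌊M⌋₊ / (c * g)), ∑ k₂ ∈ Icc 1 (⌊M⌋₊ / (c * g)),
            ((μ (c * g * k₁) : ℝ) * ((psi (c * g * k₁))⁻¹ *
                P.eval (Real.log (M / ((c * g * k₁ : ℕ) : ℝ)) / Real.log M))) / ((c * g * k₁ : ℕ) : ℝ) *
              (((μ (c * g * k₂) : ℝ) * ((psi (c * g * k₂))⁻¹ *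
                P.eval (Real.log (M / ((c * g * k₂ : ℕ) : ℝ)) / Real.log M))) / ((c * g * k₂ : ℕ) : ℝ)) *
              (t₁ k₁ * t₂ k₂) -
        (π ^ 2 / 6) ^ 2 * (∫ u in (0 : ℝ)..1, (R₁ * R₂).eval u) * Real.log M / Real.log M ^ (s₁ + s₂)| ≤
        C / Real.log M ^ (s₁ + s₂) := by
  set S₁ : ℝ → ℕ → ℝ := fun M n ↦ ∑ c ∈ Finset.range (P.natDegree + 1), P.coeff c *
    ((∑ k ∈ Icc 1 ⌊M / n⌋₊, (if k.Coprime n then W k else 0) * t₁ k * Real.log (M / n / k) ^ c) /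
      Real.log M ^ c) with hS₁
  set S₂ : ℝ → ℕ → ℝ := fun M n ↦ ∑ c ∈ Finset.range (P.natDegree + 1), P.coeff c *
    ((∑ k ∈ Icc 1 ⌊M / n⌋₊, (if k.Coprime n then W k else 0) * t₂ k * Real.log (M / n / k) ^ c) /
      Real.log M ^ c) with hS₂
  obtain ⟨C, hC, h⟩ := abs_bilinearHarmonic_two_scale_sub_le R₁ R₂ s₁ s₂ S₁ S₂ hC₁ hC₂
    (fun M hM n hn hnM ↦ by simpa only [hS₁] using h₁ M hM n hn hnM)
    (fun M hM n hn hnM ↦ by simpa only [hS₂] using h₂ M hM n hn hnM)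
  refine ⟨C, hC, fun M hM ↦ ?_⟩
  have hinner : ∀ c ∈ Icc 1 ⌊M⌋₊, ∀ g ∈ Icc 1 (⌊M⌋₊ / c),
      (μ g : ℝ) * c * ∑ k₁ ∈ Icc 1 (⌊M⌋₊ / (c * g)), ∑ k₂ ∈ Icc 1 (⌊M⌋₊ / (c * g)),
        ((μ (c * g * k₁) : ℝ) * ((psi (c * g * k₁))⁻¹ *
            P.eval (Real.log (M / ((c * g * k₁ : ℕ) : ℝ)) / Real.log M))) / ((c * g * k₁ : ℕ) : ℝ) *
          (((μ (c * g * k₂) : ℝ) * ((psi (c * g * k₂))⁻¹ *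
            P.eval (Real.log (M / ((c * g * k₂ : ℕ) : ℝ)) / Real.log M))) / ((c * g * k₂ : ℕ) : ℝ)) *
          (t₁ k₁ * t₂ k₂) =
      (μ g : ℝ) * c * (W (c * g) ^ 2 * (S₁ M (c * g) * S₂ M (c * g))) := by
    intro c hc g hg
    have hc0 : c ≠ 0 := by have := (Finset.mem_Icc.1 hc).1; omega
    have hg0 : g ≠ 0 := by have := (Finset.mem_Icc.1 hg).1; omega
    rw [selbergInner_eq_W_sq_mul P M (mul_ne_zero hc0 hg0) t₁ t₂]
  rw [Finset.sum_congr rfl fun c hc ↦ Finset.sum_congr rfl fun g hg ↦ hinner c hc g hg,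
    selbergCollapse_zero ⌊M⌋₊ (fun n ↦ W n ^ 2 * (S₁ M n * S₂ M n))]
  have hre : ∑ n ∈ Icc 1 ⌊M⌋₊, (Nat.totient n : ℝ) * (W n ^ 2 * (S₁ M n * S₂ M n)) =
      ∑ n ∈ Icc 1 ⌊M⌋₊, (Nat.totient n : ℝ) * W n ^ 2 * (S₁ M n * S₂ M n) :=
    Finset.sum_congr rfl fun n _ ↦ by ring
  rw [hre]
  exact h M hM

end Summit.Parity.GeneralizedHardyLittlewood.Theorems.MomentsBeyondDiagonal.DiagKernel

end
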